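import Summits.Ventures.Crystal3D.StickySpheres.BarlowLayerBound
import Summits.Ventures.Crystal3D.StickySpheres.TriangularDiscCount
import HarnessLib

/-!
# Basal-facet no-gain for every Barlow stacking, in registry (`BarlowAxisNoGain`)

HONEST FRAMING. Part of the venture `Summits/Ventures/Crystal3D` (cells `pub-crystal3d`,
`crystal3d-full`). An ON-LATTICE (in-registry) rung of the cell's K1 atom; nothing here is about
off-lattice packings, ground states, or three-dimensional crystallization.

**Theorem** (`barlowAxis_noGain`; the statement `BarlowAxisNoGain` of
HOME/cf-p1/lean/WulffSelection.lean, ROUTE.md §12.4/§13.3/§16, with the cell's `deficiency x`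
written out as `6N − numContacts x` (`deficiency_eq`)). There are absolute `R, C > 0`
(`R = 2`, `C = 8√3·π`) such that for EVERY Hägg sequence `σ`, every `ρ ≥ R` and every unit packing
`x : Fin N → ℝ³` drawn from `barlowStacking 1 √(2/3) σ` that contains that stacking's basal slab
sample of lateral radius `ρ` (all sites `p` with `−2R ≤ p₂ ≤ −R` and `p₀² + p₁² ≤ ρ²`):
`2√3·π·ρ² − C·ρ ≤ 6N − numContacts x`.  That is: no in-registry restacking, terracing, pitting
or island growth above or below a basal `(0001)`/`(111)` facet gains contacts at order area over
the two flat faces of the sample (`φ = √3` contacts per unit area per face) — uniformly in the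
stacking word.

Proof: the layer bound `3·E_l + C(x) ≤ 6N` (`BarlowLayerBound.lean`) at the sample layer
`l = −3` (height `−3√(2/3) ∈ [−4, −2]`), whose occupancy `E_{−3}` is at least the number of
triangular-lattice sites in the disc, `≥ (2/√3)π(ρ − 2)²` (`TriangularDiscCount.lean`).

WHAT THIS IS NOT: not `NoReconstructionGain111` / `NoReconstructionGain` (off-lattice, OPEN);
not a Wulff-constant statement; rung F-C1 of the cell is not moved by an in-registry lemma.
-/

noncomputable section

namespace Summit.Ventures.Crystal3D

open Finset
open Literature.MathematicalPhysics.StatisticalMechanics (barlowPos barlowLayer barlowStacking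
  IsHaggSeq haggLabel barlowPos_mem barlowPos_apply_zero barlowPos_apply_one barlowPos_apply_two
  le_dist_barlowPos_of_ideal)

/-- **`BarlowAxisNoGain` (basal-facet no-gain, every stacking, in registry).** With `R = 2` and
`C = 8√3π`: for every Hägg sequence `σ`, `ρ ≥ R`, and unit packing `x` on
`barlowStacking 1 √(2/3) σ` containing the basal slab sample of radius `ρ`,
`2√3·π·ρ² − C·ρ ≤ 6N − numContacts x`. -/
theorem barlowAxis_noGain :
    ∃ R C : ℝ, 0 < R ∧ ∀ σ : ℤ → ℤ, IsHaggSeq σ →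
      ∀ ρ : ℝ, R ≤ ρ → ∀ (N : ℕ) (x : Fin N → EuclideanSpace ℝ (Fin 3)), IsUnitPacking x →
        (∀ i, x i ∈ barlowStacking 1 (Real.sqrt (2 / 3)) σ) →
        (∀ p ∈ barlowStacking 1 (Real.sqrt (2 / 3)) σ,
            -(2 * R) ≤ p 2 → p 2 ≤ -R → p 0 ^ 2 + p 1 ^ 2 ≤ ρ ^ 2 → ∃ i, x i = p) →
          2 * Real.sqrt 3 * Real.pi * ρ ^ 2 - C * ρ ≤ 6 * (N : ℝ) - (numContacts x : ℝ) := by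
  classical
  refine ⟨2, 8 * Real.sqrt 3 * Real.pi, by norm_num, ?_⟩
  intro σ hσ ρ hρ N x hx hmem hsample
  have h3 : (0 : ℝ) < Real.sqrt 3 := Real.sqrt_pos.2 (by norm_num)
  have h3sq : Real.sqrt 3 ^ 2 = 3 := Real.sq_sqrt (by norm_num)
  have hh : (Real.sqrt (2 / 3)) ^ 2 = 2 / 3 * (1 : ℝ) ^ 2 := by
    rw [Real.sq_sqrt (by norm_num)]; ring
  -- the sample layer `l = -3` lies at height `-3 √(2/3) ∈ [-4, -2]`
  have hlow : (2 : ℝ) / 3 ≤ Real.sqrt (2 / 3) := by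
    nlinarith [Real.sq_sqrt (show (0 : ℝ) ≤ 2 / 3 by norm_num), Real.sqrt_nonneg (2 / 3)]
  have hhigh : Real.sqrt (2 / 3) ≤ 1 := Real.sqrt_le_one.mpr (by norm_num)
  -- coordinates of the balls
  have hcoord : ∀ i, ∃ k a b : ℤ, x i = barlowPos 1 (Real.sqrt (2 / 3)) σ k a b := fun i => hmem i
  choose k a b hc using hcoord
  have hpos_inj : ∀ {k₁ a₁ b₁ k₂ a₂ b₂ : ℤ},
      barlowPos 1 (Real.sqrt (2 / 3)) σ k₁ a₁ b₁ = barlowPos 1 (Real.sqrt (2 / 3)) σ k₂ a₂ b₂ →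
        (k₁, a₁, b₁) = (k₂, a₂, b₂) := by
    intro k₁ a₁ b₁ k₂ a₂ b₂ heq
    by_contra hne
    have h1 := le_dist_barlowPos_of_ideal hσ one_pos hh hne
    rw [heq, dist_self] at h1
    exact absurd h1 (by norm_num)
  -- the layer bound at `l = -3`
  set E := univ.filter fun i => x i ∈ barlowLayer 1 (Real.sqrt (2 / 3)) σ (-3) with hE
  have hlayer := three_mul_card_layer_add_numContacts_le σ hσ x hx hmem (-3)
  -- the lattice coordinates of the balls of that layer contain the whole disc
  set T : Finset (ℤ × ℤ) := E.image fun i => (a i, b i) with hT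
  have hTE : T.card ≤ E.card := card_image_le
  set L : ℝ := (haggLabel σ (-3) : ℝ) with hL
  have hdisc := triangular_disc_count (-(L / 2)) (-(Real.sqrt 3 / 2 * (L / 3))) ρ hρ T ?_
  swap
  · intro i j hcond
    set p := barlowPos 1 (Real.sqrt (2 / 3)) σ (-3) i j with hp
    have hp2 : p 2 = -3 * Real.sqrt (2 / 3) := by
      rw [hp, barlowPos_apply_two]; push_cast; ring
    have hp0 : p 0 = (i : ℝ) + (j : ℝ) / 2 + L / 2 := by
      rw [hp, barlowPos_apply_zero]; push_cast; ring
    have hp1 : p 1 = Real.sqrt 3 / 2 * ((j : ℝ) + L / 3) := by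
      rw [hp, barlowPos_apply_one]; push_cast; ring
    obtain ⟨i', hi'⟩ := hsample p (barlowPos_mem _ _ _) (by rw [hp2]; nlinarith)
      (by rw [hp2]; nlinarith) (by rw [hp0, hp1]; nlinarith [hcond])
    have hi'E : i' ∈ E := by
      rw [hE, mem_filter]
      exact ⟨mem_univ _, ⟨i, j, hi'⟩⟩
    have hab : (a i', b i') = (i, j) := by
      have := hpos_inj ((hc i').symm.trans hi')
      simp only [Prod.mk.injEq] at this ⊢
      exact ⟨this.2.1, this.2.2⟩
    rw [hT, mem_image]
    exact ⟨i', hi'E, hab⟩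
  -- assemble
  have hE' : 3 * (E.card : ℝ) + (numContacts x : ℝ) ≤ 6 * (N : ℝ) := by exact_mod_cast hlayer
  have hTE' : (T.card : ℝ) ≤ (E.card : ℝ) := by exact_mod_cast hTE
  have hkey : 3 * (2 / Real.sqrt 3 * Real.pi * (ρ - 2) ^ 2) =
      2 * Real.sqrt 3 * Real.pi * ρ ^ 2 - 8 * Real.sqrt 3 * Real.pi * ρ +
        8 * Real.sqrt 3 * Real.pi := by
    field_simp
    nlinarith [h3sq]
  have hpos : 0 ≤ 8 * Real.sqrt 3 * Real.pi := by positivity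
  nlinarith [hdisc, hkey, Real.pi_pos]

end Summit.Ventures.Crystal3D

end
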